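import Summits.QuantumFields.YangMills.Theorems.FluctuationComparisonRegPrIntLS2BetaRelativeTowerSupProfile
import Summits.QuantumFields.YangMills.Theorems.FluctuationComparisonRegPrIntLS2BetaContractingSupRecursion
import Summits.QuantumFields.YangMills.Theorems.FluctuationComparisonRegPrIntLS2BetaThresholdSum
import Summits.QuantumFields.YangMills.Theorems.FluctuationComparisonRegPrIntLS2BetaIterAxialGaugeSup
import HarnessLib

/-!
# S2β · `hFlat` road (UV3-NODE §57.8 (B)) — THE SUP BUDGET OF THE RELATIVE STAGE TOWER IN THE T³ READING (feeder S of ✓`…HFlatOfFeeders`):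
# for `γ ≤ γ₁(L, b₀, p₀)` every gauged level has `s′_t ≤ 1∕8` and `Σ_{t<K−J} s′_{t+1} ≤ 1∕8` — DEPTH- and VOLUME-FREE

Cell `ym3-torus` (YM ladder rung R3 = continuum `SU(2)` Yang–Mills on the three-torus — a RUNG: NOT d = 4, NOT infinite volume, NOT a mass gap,
NOT Clay).  Width seat «width 17» `ym3-torus-px17` (gen 19), FREE px helper on crux `stmt-QuantumFields-20520`
(`Theses.UnitScaleTilt.FluctuationComparisonRegPrIntL`); `--kind proof --supports stmt-QuantumFields-20520 --as helper`, count-neutral, DEFINITION-FREE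
(0 `def`, 0 `instance`, 0 `notation`, 0 `sorry`, default heartbeats; hb-100k twin clean).

WHAT.  The feeder **S** of (H) (✓`…HFlatOfFeeders.relLetter_of_feeders`: a profile `s ≥ 0` bounding the arcs of the gauged levels `U′_t := g_t • M^tU` of
the stage tower, with `Σ_{t<K−J} s (t+1) ≤ Sbud`) and the CHART GUARD every feeder needs (`s t ≤ 1∕8`: ✓p816227∕px12 (F3)'s `hs8`, the BCH sizes of the
KEY LEMMA chain), DISCHARGED in the T³ reading with `Sbud := 1∕8`:
★★★ `exists_gamma_supBudget (L) (hL : 1 < L) (b₀ p₀ > 0) : ∃ γ₁ > 0, ∀ F γ (F.L = L, 0 < γ ≤ γ₁) J ≤ K, ∀ U ∈ fibre_{J,K}(1) ∩ histGood(θBal b₀ p₀) K J,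
∀ g w V` (the stage tower over px12's HAT LIFT: `hw`∕`hV` formulas, (T1) top `1`, (T4) comb axiality, (T5) one-step consistency — the conjuncts of ✓p816142
`exists_stageGaugeTower`) `⟹ ∃ s, 0 ≤ s ∧ (∀ t ≤ K−J, ∀ b, arc (U′_t b) ≤ s t) ∧ (∀ t ≤ K−J, s t ≤ 1∕8) ∧ Σ_{t<K−J} s (t+1) ≤ 1∕8`.
CHAIN (all by name): ✓p816895 `exists_supProfile_relativeTower` (the conditional quadratic step; `histGood`'s thresholds `θBal(K−t)` read on the gauged levels
by gauge invariance, the top flat by ✓`iter_eq_one_of_mem_fibre_one` + (T1)) with `ρ t := A₁·θBal(K−t) + A₂·θBal(K−t−1)`, `r₀ := L⁻¹`, `σ₀ := 1∕4` ∘ px16 g20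
✓p816768 `sup_bootstrap` (every level `≤ 2·Sρ∕(1−r₀)`) ∕ `linearised_of_bootstrap` ∕ `sum_succ_le_of_contract` (`Σ s(t+1) ≤ Σρ∕(1−r)`) ∘ px10 g21
✓`thresholdSum_small` (`(A₁+A₂)·Σ_{i<K−J} θBal(K−i) ≤ Sρ∕2` and `θBal ≤ a₀` for `γ ≤ γ₁`), with `Sρ := min((1−r₀)∕16, (1−r₀)²∕(4(C₂+1)))` and `a₀` below the
`ℰp` guards (`((d+2)L)²∕4·a₀ < δ_SU`, `≤ 1∕6`) and `≤ Sρ∕(2(A₂+1))` (the one threshold `θBal(J)` outside the printed sum).  Constants at `d = 3`: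
`N_P = 2·((L−1)∕2)·(L+1)`, `G = (5L)²∕4`, `A₁ = (π∕2)(N_P + 2G)`, `A₂ = (π∕2)·N_P·L⁻²·(π∕2)`, `C₂ = 12π·N_P·L⁻²`.

SO (with ✓p816498 ∘ ✓`…HFlatOfFeeders`): of (H)'s feeders {F1 KEY LEMMA, F2 ✓p816657, F3 px12 (ii-c)-ℓ², F4 corr-ℓ² (px21∕px10), S}, **S is DISCHARGED** —
`E = (π∕2)·√(2Cs)·C_S·(1∕8)∕√L` is depth-free by construction.

HONEST SCOPE.  Real-inequality bookkeeping over landed letters (every constant explicit and crude); nothing of Bałaban's analysis is asserted or proved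
([Balaban1985RegularSpaces] (1.65) p.87 is the printed iteration of the one-level sup letter; [Balaban1985UV3] (7) p.257 the small-field history); F1, F3, F4,
(H), `hFlat`, TUBE-REG∘, GAP♯∘ (`stub_uniformFibreGapOrbit`), S2β, crux 20520 and `YM3TorusSU2` are NOT proved; no registered stub is closed; rung R3 = SU(2) YM₃
on T³ at fixed lattice data — NOT d = 4, NOT infinite volume, NOT a mass gap, NOT Clay; the Yang–Mills mass gap is NOT proved.
References: T. Bałaban, CMP **99** (1985) 75–102 [Balaban1985RegularSpaces] ((1.65) p.87); CMP **102** (1985) 255–275 [Balaban1985UV3] ((7) p.257).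
-/

set_option autoImplicit false

noncomputable section

namespace Summit.QuantumFields.YangMills.Theorems.FluctuationComparisonRegPrIntLS2BetaRelativeTowerSupBudget

open Finset
open scoped Real
open Literature.MathematicalPhysics.QuantumLattice (su2Quat)
open Literature.MathematicalPhysics.QuantumFieldTheory.Balaban1983to89
open T4Continuum T3ContinuumYM3Torus T3UnitScaleTilt BlockAveraging
open T4CubeChartGnomonic (SU2)
open T4HaarSU2ExpChart (expPoint)
open T4ExpWindowSmallField (logVec)
open T3UnitLawDensityEML (ℰp)
open T3ConstrainedMinimiser (fibre)
open B10Eq27TorusAxialLog (rel axialT)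
open Summit.QuantumFields.YangMills.Theorems.FluctuationComparisonRegPrIntLS2BetaRelativeTowerSupProfile (exists_supProfile_relativeTower)
open Summit.QuantumFields.YangMills.Theorems.FluctuationComparisonRegPrIntLS2BetaContractingSupRecursion (sup_bootstrap linearised_of_bootstrap sum_succ_le_of_contract)
open Summit.QuantumFields.YangMills.Theorems.FluctuationComparisonRegPrIntLS2BetaThresholdSum (thresholdSum_small)
open Summit.QuantumFields.YangMills.Theorems.FluctuationComparisonRegPrIntLS2BetaIterAxialGaugeSup (iter_eq_one_of_mem_fibre_one)

/-- ★★★ **THE SUP BUDGET, T³ READING**: for every block size `L > 1` and profile `b₀, p₀ > 0` there is `γ₁ > 0` such that for every `T³`-family with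
`F.L = L`, every `0 < γ ≤ γ₁`, every run pair `J ≤ K`, every good history `U` over the flat datum, and every STAGE TOWER `g` over the HAT LIFT (the
data of ✓p816142 `exists_stageGaugeTower` with px12's lift: (T1) top `1`, (T4) comb axiality, (T5) one-step consistency), the sup profile `s′` of the
gauged levels `U′_t := g_t • M^tU` satisfies `0 ≤ s′`, `arc (U′_t b) ≤ s′_t`, **`s′_t ≤ 1∕8` at every level and `Σ_{t<K−J} s′_{t+1} ≤ 1∕8`** — depth-
and volume-free.  Chain: ✓p816895 `exists_supProfile_relativeTower` (the conditional quadratic step, `histGood`'s thresholds read on the gauged levels by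
gauge invariance) ∘ px16 g20 ✓p816768 `sup_bootstrap`∕`linearised_of_bootstrap`∕`sum_succ_le_of_contract` ∘ ✓`thresholdSum_small` (the threshold sum is
as small as desired for `γ ≤ γ₁`). [cite: Balaban1985RegularSpaces, (1.65) p.87; Balaban1985UV3, (7) p.257] -/
theorem exists_gamma_supBudget (L : ℕ) (hL : 1 < L) (b₀ p₀ : ℝ) (hb : 0 < b₀) (hp : 0 < p₀) :
    ∃ γ₁ : ℝ, 0 < γ₁ ∧ ∀ (F : T3Family) (γ : ℝ), F.L = L → 0 < γ → γ ≤ γ₁ → ∀ (J K : ℕ) (hJK : J ≤ K)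
      (U : GaugeField (F.P K) 0 SU2), U ∈ fibre F ℰp J K hJK (1 : GaugeField (F.P J) 0 SU2) → U ∈ histGood F ℰp (θBal F.L γ b₀ p₀) K J →
      ∀ (g : (j : ℕ) → Site (F.P K) j → SU2) (w : (t : ℕ) → PBond (F.P K) t → PBond (F.P K) (t + 1) → ℝ)
        (V : (t : ℕ) → GaugeField (F.P K) t SU2),
        (∀ t, t < K - J → ∀ b e, w t b e = if e.dir = b.dir ∧ (b.src b.dir - emb e.src b.dir).val < (F.P K).L then
          ∏ ν ∈ Finset.univ.erase b.dir, max 0 (1 - ((rel (emb e.src) b.src ν).natAbs : ℝ) / (F.P K).L) else 0) →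
        (∀ t, t < K - J → ∀ b, V t b = expPoint (∑ e, w t b e • ((((F.P K).L : ℕ) : ℝ)⁻¹ •
          logVec (su2Quat (GaugeField.gaugeAct (g (t + 1)) (Averaging.iter (fun k => blockAvg (P := F.P K) (j := k) ℰp) (t + 1) U) e))))) →
        (∀ j, K - J ≤ j → ∀ y, g j y = 1) →
        (∀ t, t < K - J → ∀ z : Site (F.P K) t,
          axialT (GaugeField.gaugeAct (g t) (Averaging.iter (fun k => blockAvg (P := F.P K) (j := k) ℰp) t U)) (emb (blockOf z)) z =
            axialT (V t) (emb (blockOf z)) z) →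
        (∀ t, t < K - J → avgFun ℰp (GaugeField.gaugeAct (g t) (Averaging.iter (fun k => blockAvg (P := F.P K) (j := k) ℰp) t U)) =
          GaugeField.gaugeAct (g (t + 1)) (Averaging.iter (fun k => blockAvg (P := F.P K) (j := k) ℰp) (t + 1) U)) →
        ∃ s : ℕ → ℝ, (∀ t, 0 ≤ s t) ∧
          (∀ t, t ≤ K - J → ∀ b, ‖logVec (su2Quat (GaugeField.gaugeAct (g t) (Averaging.iter (fun k => blockAvg (P := F.P K) (j := k) ℰp) t U) b))‖ ≤ s t) ∧
          (∀ t, t ≤ K - J → s t ≤ 1 / 8) ∧ ∑ t ∈ range (K - J), s (t + 1) ≤ 1 / 8 := by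
  -- the constants of the one-level step at `d = 3`, block size `L`
  have hL' : (1 : ℝ) < L := by exact_mod_cast hL
  have hL0 : (0 : ℝ) < L := by linarith
  obtain ⟨NP, hNP⟩ : ∃ x : ℝ, x = (((3 - 1) * ((L - 1) / 2) * (L + 1) : ℕ) : ℝ) := ⟨_, rfl⟩
  obtain ⟨G, hG⟩ : ∃ x : ℝ, x = ((((3 + 2) * L : ℕ) : ℝ) ^ 2 / 4) := ⟨_, rfl⟩
  have hNP0 : 0 ≤ NP := by rw [hNP]; positivity
  have hG0 : 0 < G := by rw [hG]; positivity
  obtain ⟨A₁, hA₁⟩ : ∃ x : ℝ, x = π / 2 * (NP + 2 * G) := ⟨_, rfl⟩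
  obtain ⟨A₂, hA₂⟩ : ∃ x : ℝ, x = π / 2 * (NP * ((L : ℝ)⁻¹) ^ 2 * (π / 2)) := ⟨_, rfl⟩
  obtain ⟨C₂, hC₂⟩ : ∃ x : ℝ, x = π / 2 * NP * 24 * ((L : ℝ)⁻¹) ^ 2 := ⟨_, rfl⟩
  obtain ⟨r₀, hr₀⟩ : ∃ x : ℝ, x = (L : ℝ)⁻¹ := ⟨_, rfl⟩
  have hA₁0 : 0 ≤ A₁ := by rw [hA₁]; positivity
  have hA₂0 : 0 ≤ A₂ := by rw [hA₂]; positivity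
  have hC₂0 : 0 ≤ C₂ := by rw [hC₂]; positivity
  have hr00 : 0 ≤ r₀ := by rw [hr₀]; positivity
  have hr01 : r₀ < 1 := by rw [hr₀]; exact inv_lt_one_of_one_lt₀ hL'
  have h1r : 0 < 1 - r₀ := by linarith
  -- the target size of the threshold sum
  obtain ⟨Smax, hSmax⟩ : ∃ x : ℝ, x = min ((1 - r₀) / 16) ((1 - r₀) ^ 2 / (4 * (C₂ + 1))) := ⟨_, rfl⟩
  have hSmax0 : 0 < Smax := by rw [hSmax]; exact lt_min (by positivity) (by positivity)
  -- the size guard for a single threshold: the `ℰp` guards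
  have hδSU := ExpMeanLog.deltaSU_pos (n := Fin 2)
  obtain ⟨a₀, ha₀⟩ : ∃ x : ℝ, x = min (min (ExpMeanLog.deltaSU (Fin 2) / (2 * G)) (1 / (6 * G))) (Smax / (2 * (A₂ + 1))) := ⟨_, rfl⟩
  have ha₀0 : 0 < a₀ := by rw [ha₀]; exact lt_min (lt_min (by positivity) (by positivity)) (by positivity)
  obtain ⟨γ₁, hγ₁, hth⟩ := thresholdSum_small L hL b₀ p₀ hb hp (A₁ + A₂) a₀ (Smax / 2) (by positivity) ha₀0 (by positivity)
  refine ⟨γ₁, hγ₁, fun F γ hFL hγ hγ1 J K hJK U hUf hUg g w V hw hV hT1 hax hT5 => ?_⟩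
  obtain ⟨hθa, hsum⟩ := hth γ hγ hγ1
  have hPd : (F.P K).d = 3 := rfl
  have hPL : (F.P K).L = L := hFL
  rw [hFL] at hUg
  have hm : K - J ≤ (F.P K).m + (F.P K).K := by show K - J ≤ F.m + K; omega
  -- thresholds on the gauged levels (gauge invariance of plaquette sizes)
  set θ : ℕ → ℝ := fun t => θBal L γ b₀ p₀ (K - t) with hθ
  have hθ0 : ∀ t, 0 ≤ θ t := fun t => (hθa _).1
  have hθa' : ∀ t, θ t ≤ a₀ := fun t => (hθa _).2
  have htop : GaugeField.gaugeAct (g (K - J)) (Averaging.iter (fun k => blockAvg (P := F.P K) (j := k) ℰp) (K - J) U) = 1 := by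
    rw [iter_eq_one_of_mem_fibre_one F hJK hUf, funext (hT1 (K - J) le_rfl), T4AxialGaugeFixing.gaugeAct_const_one]
  have hθU : ∀ t, t ≤ K - J → PlaqSmall (θ t) (GaugeField.gaugeAct (g t) (Averaging.iter (fun k => blockAvg (P := F.P K) (j := k) ℰp) t U)) := by
    intro t ht p
    rw [T4ReTrLipUnitary.plaqHol_gaugeAct, GaugeGroup.dist1_conj]
    exact hUg t (by omega) p
  -- the guards from `θ ≤ a₀`
  have hGa : G * a₀ < ExpMeanLog.deltaSU (Fin 2) ∧ G * a₀ ≤ 1 / 6 := by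
    have h1 : a₀ ≤ ExpMeanLog.deltaSU (Fin 2) / (2 * G) := by rw [ha₀]; exact (min_le_left _ _).trans (min_le_left _ _)
    have h2 : a₀ ≤ 1 / (6 * G) := by rw [ha₀]; exact (min_le_left _ _).trans (min_le_right _ _)
    constructor
    · calc G * a₀ ≤ G * (ExpMeanLog.deltaSU (Fin 2) / (2 * G)) := mul_le_mul_of_nonneg_left h1 hG0.le
        _ = ExpMeanLog.deltaSU (Fin 2) / 2 := by field_simp
        _ < ExpMeanLog.deltaSU (Fin 2) := by linarith
    · calc G * a₀ ≤ G * (1 / (6 * G)) := mul_le_mul_of_nonneg_left h2 hG0.le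
        _ = 1 / 6 := by field_simp
  have hg1 : ∀ t, t < K - J → (((((F.P K).d + 2) * (F.P K).L : ℕ) : ℝ) ^ 2 / 4) * θ t < ExpMeanLog.deltaSU (Fin 2) := by
    intro t _; rw [hPd, hPL, ← hG]
    exact lt_of_le_of_lt (mul_le_mul_of_nonneg_left (hθa' t) hG0.le) hGa.1
  have hg2 : ∀ t, t < K - J → (((((F.P K).d + 2) * (F.P K).L : ℕ) : ℝ) ^ 2 / 4) * θ t ≤ 1 / 6 := by
    intro t _; rw [hPd, hPL, ← hG]
    exact le_trans (mul_le_mul_of_nonneg_left (hθa' t) hG0.le) hGa.2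
  -- the profile and its conditional quadratic step (✓p816895 §4)
  obtain ⟨s, hsm, hs0, hsb, hstep⟩ := exists_supProfile_relativeTower hm
    (fun t => GaugeField.gaugeAct (g t) (Averaging.iter (fun k => blockAvg (P := F.P K) (j := k) ℰp) t U)) w V hw hV hax hT5 htop θ hθ0 hθU hg1 hg2
  -- the step in the bootstrap's currency
  set ρ : ℕ → ℝ := fun t => A₁ * θ t + A₂ * θ (t + 1) with hρ
  have hρ0 : ∀ t, 0 ≤ ρ t := fun t => add_nonneg (mul_nonneg hA₁0 (hθ0 t)) (mul_nonneg hA₂0 (hθ0 _))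
  have hstep' : ∀ t, t < K - J → s (t + 1) ≤ 1 / 4 → s t ≤ r₀ * s (t + 1) + ρ t + C₂ * s (t + 1) ^ 2 := by
    intro t ht h4
    have h := hstep t ht h4
    rw [hPd, hPL] at h
    refine h.trans (le_of_eq ?_)
    simp only [hρ, hA₁, hA₂, hC₂, hr₀, hNP, hG]
    ring
  -- the threshold sum: `Σ_{t<m} ρ t ≤ (A₁ + A₂)·Σθ + A₂·a₀ ≤ Smax`
  have hSρ : ∑ t ∈ range (K - J), ρ t ≤ Smax := by
    have hs1 : ∑ t ∈ range (K - J), ρ t =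
        A₁ * ∑ t ∈ range (K - J), θ t + A₂ * ∑ t ∈ range (K - J), θ (t + 1) := by
      simp only [hρ, sum_add_distrib, mul_sum]
    have hshift : ∑ t ∈ range (K - J), θ (t + 1) ≤ ∑ t ∈ range (K - J), θ t + a₀ := by
      rcases Nat.eq_zero_or_pos (K - J) with h0 | hpos
      · rw [h0]; simp [ha₀0.le]
      · obtain ⟨m, hm'⟩ : ∃ m, K - J = m + 1 := ⟨K - J - 1, by omega⟩
        rw [hm', Finset.sum_range_succ' θ, Finset.sum_range_succ (fun t => θ (t + 1))]
        have := hθ0 0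
        have := hθa' (m + 1)
        linarith
    have hmain := hsum J K hJK
    have hθsum0 : 0 ≤ ∑ t ∈ range (K - J), θ t := sum_nonneg fun t _ => hθ0 t
    have ha₀S : A₂ * a₀ ≤ Smax / 2 := by
      have h3 : a₀ ≤ Smax / (2 * (A₂ + 1)) := by rw [ha₀]; exact min_le_right _ _
      calc A₂ * a₀ ≤ A₂ * (Smax / (2 * (A₂ + 1))) := mul_le_mul_of_nonneg_left h3 hA₂0
        _ ≤ (A₂ + 1) * (Smax / (2 * (A₂ + 1))) := mul_le_mul_of_nonneg_right (by linarith) (by positivity)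
        _ = Smax / 2 := by field_simp
    rw [hs1]
    have hA₂sh := mul_le_mul_of_nonneg_left hshift hA₂0
    calc A₁ * ∑ t ∈ range (K - J), θ t + A₂ * ∑ t ∈ range (K - J), θ (t + 1)
        ≤ A₁ * ∑ t ∈ range (K - J), θ t + A₂ * (∑ t ∈ range (K - J), θ t + a₀) := by linarith
      _ = (A₁ + A₂) * ∑ i ∈ range (K - J), θBal L γ b₀ p₀ (K - i) + A₂ * a₀ := by simp only [hθ]; ring
      _ ≤ Smax / 2 + Smax / 2 := add_le_add hmain ha₀S
      _ = Smax := by ring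
  -- the bootstrap (px16 ✓p816768): every level ≤ 2·Smax∕(1 − r₀) ≤ 1∕8, and the linearised contraction
  have hS16 : Smax ≤ (1 - r₀) / 16 := by rw [hSmax]; exact min_le_left _ _
  have hsmall₁' : 2 * Smax / (1 - r₀) ≤ 1 / 8 := by
    rw [div_le_iff₀ h1r]; linarith
  have hsmall₁ : 2 * Smax / (1 - r₀) ≤ 1 / 4 := hsmall₁'.trans (by norm_num)
  have hsmall₂ : C₂ * (2 * Smax / (1 - r₀)) ≤ (1 - r₀) / 2 := by
    have h4 : Smax ≤ (1 - r₀) ^ 2 / (4 * (C₂ + 1)) := by rw [hSmax]; exact min_le_right _ _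
    have h4' : Smax * (4 * (C₂ + 1)) ≤ (1 - r₀) ^ 2 := (le_div_iff₀ (by positivity)).mp h4
    rw [mul_div_assoc', div_le_iff₀ h1r]
    calc C₂ * (2 * Smax) ≤ (C₂ + 1) * (2 * Smax) := mul_le_mul_of_nonneg_right (by linarith) (by positivity)
      _ = Smax * (4 * (C₂ + 1)) / 2 := by ring
      _ ≤ (1 - r₀) ^ 2 / 2 := div_le_div_of_nonneg_right h4' (by norm_num)
      _ = (1 - r₀) / 2 * (1 - r₀) := by ring
  have hbound := sup_bootstrap s ρ (K - J) r₀ C₂ (1 / 4) Smax hsm hs0 hρ0 hSρ hstep' hr00 hr01 hC₂0 hsmall₁ hsmall₂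
  obtain ⟨hr0', hr1', hlin⟩ := linearised_of_bootstrap s ρ (K - J) r₀ C₂ (1 / 4) Smax hsm hs0 hρ0 hSρ hstep' hr00 hr01 hC₂0 hsmall₁ hsmall₂
  have hsumS := sum_succ_le_of_contract _ hr0' hr1' s ρ (K - J) hsm (hs0 0) hlin
  refine ⟨s, hs0, hsb, fun t ht => (hbound t ht).trans hsmall₁', hsumS.trans ?_⟩
  -- `Σρ∕(1 − r) ≤ Smax∕((1 − r₀)∕2) = 2·Smax∕(1 − r₀) ≤ 1∕8`
  have h1r' : (1 - r₀) / 2 ≤ 1 - (r₀ + C₂ * (2 * Smax / (1 - r₀))) := by linarith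
  calc (∑ t ∈ range (K - J), ρ t) / (1 - (r₀ + C₂ * (2 * Smax / (1 - r₀))))
      ≤ Smax / ((1 - r₀) / 2) := div_le_div₀ hSmax0.le hSρ (by positivity) h1r'
    _ = 2 * Smax / (1 - r₀) := by field_simp
    _ ≤ 1 / 8 := hsmall₁'

end Summit.QuantumFields.YangMills.Theorems.FluctuationComparisonRegPrIntLS2BetaRelativeTowerSupBudget

end
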